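/-
Copyright (c) 2026 the pub-hodgecm-mathlib formalisation cell (harness21).  Prover seat hodgecm-mathlib-K2E2-p12 (g6): Track B «K2-LIT», ENGINE E1,
h413 = stmt-HodgeConjecture-24833; line `K2_E1_TraceFormulaBeta`, 5Res campaign «ENDGAME BY FAMILIES», ROADCARD §3′ (M2 v2, amendment #2), deal (253) of K2E1-plan (g7):
THE ALGEBRA-FREE E1 PRINT of ★ D5′ — ★ p860487's skeleton with `T_j := R_∞(h_j) ∘L R_f(e)` and the letters `hT𝓐`, `hTP` PLUGGED BY NAME (★ p860333 ∕ p860372).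
-/
import Summits.HodgeConjecture.HodgeConjecture.Theorems.K2E1IrreducibleNoContinuousSpectrumCMTwoOfLetters   -- ★ p860487 (K2E4-p23) the E1 skeleton (brings ★ p860349 D5′, ★ p860403 letters, ★ p860333)
import Summits.HodgeConjecture.HodgeConjecture.Theorems.K2E1KTypeProjectorPureTensorU                      -- ★ p860372: `kType_comm_restrict` (hP), `hh_of_spherical` (hh)
import HarnessLib

/-!
# K2·E1 — `K2E1IrreducibleNoContinuousSpectrumCMTwoAlgebraFree`: ★ D5′ AT `U(H)(𝔸_{L⁺})` WITH THE HECKE OPERATORS `T_j := R_∞(h_j) ∘ R_f(e)` — the letters `hT𝓐` and `hTP` of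
# ★ p860487 DISCHARGED BY NAME; only the compression letter `hTB` (K2E4-p10's A2) and the MODEL letters `U s hU hline` remain (deal (253); every `N`, every `H`)

Track B ∕ K2-LIT, crux h413 = `stmt-HodgeConjecture-24833`, route of record `HCCMUnconditional`; cell `hodgecm-mathlib`, squad K2, ENGINE E1 (5Res campaign, M2 v2 §3′.1 (ii′)(iii′)).
THEOREMS ONLY (no `def`, no `instance`, no notation, no named-fact hypothesis, no `sorry`; default heartbeats); lane `--supports stmt-HodgeConjecture-24833 --as helper` (count-neutral).
CLOSES NO SOCKET.  Conditional by construction on the visible letters `hTB`, `U s hs hU hline` (and the data of the block projector); unconditional in everything it discharges.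

WHAT IS PLUGGED, BY NAME, on top of ★ p860487 `indicator_lpSMul_blockProj_eq_zero_of_irreducible_subrep_cm` (K2E4-p23): the Hecke operators are the PURE TENSORS `T_j = R_∞(h_j) ∘L R_f(e)` with
`h_j ∈ C_c(U(H)(L⁺ ⊗ ℝ))` `χ`-SPHERICAL for the compact `κ : K →* U(H)(L⁺⊗ℝ)` (`h_j(κk·x) = χ(k) h_j(x) = h_j(x·κk)`) and `e = e_{K′}` the level kernel of the block projector `P = P_χ ∘L R_f(e)`:
* `hT𝓐 : T_j ∈ 𝓐` — `⟨h_j, e, rfl⟩`;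
* `hTP : Commute P (T_j)` — ★ p860333 `commute_pureTensor_of_separate` with `hP` = ★ p860372 `kType_comm_restrict` (the `K`-type projector commutes with `π(1, g_f)`), `hh` = ★ p860372
  `hh_of_spherical` (`R_∞(h_j) P_χ = P_χ R_∞(h_j)` for `χ`-spherical `h_j`; `ν_∞` two-sided invariant — right-invariance derived from left- and inversion-invariance) and `het` trivial (`t = e`).
HEADS: **`indicator_lpSMul_blockProj_eq_zero_of_spherical_cm`** (general line part `Λ`) and **`lpModel_blockProj_eq_zero_of_spherical_cm`** (`Λ = univ`: `U (P w) = 0`).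
REMAINING LETTERS: `hTB` «`T_j|_{V_P}` commutes with the compressions `P A P`» (payer K2E4-p10 A1∕A2 ★ p860591 + `K2E1CompressionCommuteOfSphericalU`, which consumes the Gelfand print ★ p860595
`integratedOperator_arch_comm_of_spherical_two`), the MODEL `U s hs hU` (D4′b-2∕D4′d), `hline` (★ (α)), and the block-projector data `(κ, μ, χ; e, K′)`.
HONEST LABEL: HC_CM is proved only modulo the 7 printed citations (2 remaining named inputs: hLiu418 = `stmt-HodgeConjecture-24832`, h413 = `stmt-HodgeConjecture-24833`) until rung 0
closes; this file asserts no named fact and closes no socket; count-neutral.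

## References
* [MoeglinWaldspurger1995] C. Mœglin, J.-L. Waldspurger, *Spectral decomposition and Eisenstein series* (1995), IV.3.12 (b), VI.2.
* [DeitmarEchterhoff2014] A. Deitmar, S. Echterhoff, *Principles of Harmonic Analysis* (2014), Prop. 6.2.1, Lemma 6.1.7.
* [Knapp1986] A. W. Knapp, *Representation Theory of Semisimple Groups* (1986), VIII §3.
-/

set_option autoImplicit false
set_option linter.dupNamespace false -- the mandated namespace repeats `HodgeConjecture.HodgeConjecture`

noncomputable section

open MeasureTheory Filter Topology CompactlySupported NumberField ContRepresentation Set
open scoped InnerProductSpace ENNReal ComplexConjugate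
open Literature.NumberTheory.Automorphic Literature.NumberTheory.Automorphic.UnitaryGroup AdelicGroupData
open Summit.HodgeConjecture.HodgeConjecture.Cruxes.H413.K2E1IrreducibleNoContinuousSpectrumCMTwoOfLetters (indicator_lpSMul_blockProj_eq_zero_of_irreducible_subrep_cm lpModel_blockProj_eq_zero_of_irreducible_subrep_cm)
open Summit.HodgeConjecture.HodgeConjecture.Cruxes.H413.K2E1PureTensorHeckeAlgebraU (commute_pureTensor_of_separate cm_hcomm)
open Summit.HodgeConjecture.HodgeConjecture.Cruxes.H413.K2E1KTypeProjectorPureTensorU (kType_comm_restrict hh_of_spherical)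

namespace Summit.HodgeConjecture.HodgeConjecture.Cruxes.H413.K2E1IrreducibleNoContinuousSpectrumCMTwoAlgebraFree

variable {L : Type} [Field L] [NumberField L] [IsCMField L] {N : ℕ} {H : Matrix (Fin N) (Fin N) L}
  {K V : Type*} [Group K] [TopologicalSpace K] [MeasurableSpace K] [BorelSpace K]
  [NormedAddCommGroup V] [InnerProductSpace ℂ V] [CompleteSpace V]
  (π : ContRepresentation ℂ (cmDatum L N H).Adelic V) (hu : π.IsUnitary) (hc : π.IsStronglyContinuous)
  [MeasurableSpace (UnitaryGroup.arch (↥(maximalRealSubfield L)) L (IsCMField.complexConj L) N H)] [BorelSpace (UnitaryGroup.arch (↥(maximalRealSubfield L)) L (IsCMField.complexConj L) N H)]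
  [MeasurableSpace (finAdelic (↥(maximalRealSubfield L)) L (IsCMField.complexConj L) N H)] [BorelSpace (finAdelic (↥(maximalRealSubfield L)) L (IsCMField.complexConj L) N H)]
  (νinf : Measure (UnitaryGroup.arch (↥(maximalRealSubfield L)) L (IsCMField.complexConj L) N H)) [IsFiniteMeasureOnCompacts νinf] [νinf.IsMulLeftInvariant] [νinf.IsInvInvariant] [νinf.IsOpenPosMeasure]
  (νf : Measure (finAdelic (↥(maximalRealSubfield L)) L (IsCMField.complexConj L) N H)) [IsFiniteMeasureOnCompacts νf] [νf.IsMulLeftInvariant] [νf.IsInvInvariant] [νf.IsOpenPosMeasure]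
  (κ : K →* UnitaryGroup.arch (↥(maximalRealSubfield L)) L (IsCMField.complexConj L) N H) (hκ : Continuous κ)
  (μ : Measure K) [IsFiniteMeasureOnCompacts μ] [IsProbabilityMeasure μ] [MeasurableMul K] [μ.IsMulLeftInvariant] [MeasurableInv K] [μ.IsInvInvariant]
  (χ : C_c(K, ℂ)) (e : C_c(finAdelic (↥(maximalRealSubfield L)) L (IsCMField.complexConj L) N H, ℂ))
  {Ω : Type*} {mΩ : MeasurableSpace Ω} {m : Measure Ω} {E : Type*} [NormedAddCommGroup E] [NormedSpace ℂ E] {J : Type*} [Countable J]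
variable [ENNReal.HolderTriple ∞ 2 2]

omit [νinf.IsOpenPosMeasure] [νf.IsMulLeftInvariant] [νf.IsInvInvariant] [νf.IsOpenPosMeasure] [MeasurableMul K] [μ.IsMulLeftInvariant] [MeasurableInv K] [μ.IsInvInvariant]
  [ENNReal.HolderTriple ∞ 2 2] in
/-- **`hTP` DISCHARGED: `P = P_χ ∘ R_f(e)` COMMUTES WITH `T_j = R_∞(h_j) ∘ R_f(e)`** for `χ`-spherical `h_j` (separate variables: ★ `commute_pureTensor_of_separate` with ★ `kType_comm_restrict` and ★
`hh_of_spherical`; `ν_∞` left- and inversion-invariant, hence right-invariant). [cite: Knapp1986, VIII §3] [cite: DeitmarEchterhoff2014, Prop. 6.2.1] -/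
theorem commute_blockProjector_sphericalHecke (hχmul : ∀ k l, χ (k * l) = χ k * χ l) (hχone : χ 1 = 1)
    (h : C_c(UnitaryGroup.arch (↥(maximalRealSubfield L)) L (IsCMField.complexConj L) N H, ℂ)) (hhl : ∀ (k : K) (x : UnitaryGroup.arch (↥(maximalRealSubfield L)) L (IsCMField.complexConj L) N H), h (κ k * x) = χ k * h x) (hhr : ∀ (k : K) (x : UnitaryGroup.arch (↥(maximalRealSubfield L)) L (IsCMField.complexConj L) N H), h (x * κ k) = χ k * h x) :
    Commute ((π.restrict ((archToAdelic (↥(maximalRealSubfield L)) L (IsCMField.complexConj L) N H).comp κ)).integratedOperator (hu.restrict _)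
          (hc.restrict _ ((continuous_archToAdelic (↥(maximalRealSubfield L)) L (IsCMField.complexConj L) N H).comp hκ)) μ χ ∘L
        (π.restrict (finAdelicToAdelic (↥(maximalRealSubfield L)) L (IsCMField.complexConj L) N H)).integratedOperator (hu.restrict _) (hc.restrict _ (continuous_finAdelicToAdelic (↥(maximalRealSubfield L)) L (IsCMField.complexConj L) N H)) νf e)
      ((π.restrict (archToAdelic (↥(maximalRealSubfield L)) L (IsCMField.complexConj L) N H)).integratedOperator (hu.restrict _) (hc.restrict _ (continuous_archToAdelic (↥(maximalRealSubfield L)) L (IsCMField.complexConj L) N H)) νinf h ∘L (π.restrict (finAdelicToAdelic (↥(maximalRealSubfield L)) L (IsCMField.complexConj L) N H)).integratedOperator (hu.restrict _) (hc.restrict _ (continuous_finAdelicToAdelic (↥(maximalRealSubfield L)) L (IsCMField.complexConj L) N H)) νf e) := by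
  haveI : νinf.IsMulRightInvariant := by
    have hinv : νinf.inv.IsMulRightInvariant := inferInstance
    rwa [Measure.inv_eq_self] at hinv
  exact (commute_pureTensor_of_separate π hu hc _ (continuous_archToAdelic (↥(maximalRealSubfield L)) L (IsCMField.complexConj L) N H)
    _ (continuous_finAdelicToAdelic (↥(maximalRealSubfield L)) L (IsCMField.complexConj L) N H) νinf νf cm_hcomm _
    (kType_comm_restrict π hu hc _ (continuous_archToAdelic (↥(maximalRealSubfield L)) L (IsCMField.complexConj L) N H) _ κ hκ μ χ cm_hcomm) h e e
    (hh_of_spherical π hu hc _ (continuous_archToAdelic (↥(maximalRealSubfield L)) L (IsCMField.complexConj L) N H) κ hκ μ χ νinf hχmul hχone h hhl hhr) rfl).symm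

/-- **★ D5′ AT `U(H)(𝔸_{L⁺})` WITH `T_j = R_∞(h_j) ∘ R_f(e)`, `hT𝓐`∕`hTP` PLUGGED** (general line part `Λ`): for `χ`-spherical `h_j`, the compression letter `hTB`, a linear model `U` with symbols `s_j`
(`hs`, `hU`) and the line letter (hline), every topologically irreducible closed `W ≤ V` and `w ∈ W` satisfy **`𝟙_Λ • U (P w) = 0`** (★ p860487 + `commute_blockProjector_sphericalHecke`).
[cite: MoeglinWaldspurger1995, IV.3.12, VI.2] [cite: DeitmarEchterhoff2014, Lemma 6.1.7] -/
theorem indicator_lpSMul_blockProj_eq_zero_of_spherical_cm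
    (hχmul : ∀ k l, χ (k * l) = χ k * χ l) (hχone : χ 1 = 1) (hχinv : ∀ k, conj (χ k⁻¹) = χ k)
    (K' : Subgroup (finAdelic (↥(maximalRealSubfield L)) L (IsCMField.complexConj L) N H)) (he0 : ∀ x, x ∉ K' → e x = 0) (he1 : ∫ x, e x ∂νf = 1)
    (heK : ∀ k ∈ K', ∀ x, e (k * x) = e x) (hestar : ∀ x, mulStar (⇑e) x = e x)
    (P : V →L[ℂ] V) (hPdef : P = ((π.restrict ((archToAdelic (↥(maximalRealSubfield L)) L (IsCMField.complexConj L) N H).comp κ)).integratedOperator (hu.restrict _)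
          (hc.restrict _ ((continuous_archToAdelic (↥(maximalRealSubfield L)) L (IsCMField.complexConj L) N H).comp hκ)) μ χ ∘L
        (π.restrict (finAdelicToAdelic (↥(maximalRealSubfield L)) L (IsCMField.complexConj L) N H)).integratedOperator (hu.restrict _) (hc.restrict _ (continuous_finAdelicToAdelic (↥(maximalRealSubfield L)) L (IsCMField.complexConj L) N H)) νf e))
    (W : ClosedSubrep π) (hW : W.toContRep.IsTopIrreducible)
    (h : J → C_c(UnitaryGroup.arch (↥(maximalRealSubfield L)) L (IsCMField.complexConj L) N H, ℂ))
    (hhl : ∀ (j : J) (k : K) (x : UnitaryGroup.arch (↥(maximalRealSubfield L)) L (IsCMField.complexConj L) N H), h j (κ k * x) = χ k * h j x)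
    (hhr : ∀ (j : J) (k : K) (x : UnitaryGroup.arch (↥(maximalRealSubfield L)) L (IsCMField.complexConj L) N H), h j (x * κ k) = χ k * h j x)
    (hTB : ∀ j, ∀ A ∈ {A : V →L[ℂ] V | ∃ (a : C_c(UnitaryGroup.arch (↥(maximalRealSubfield L)) L (IsCMField.complexConj L) N H, ℂ)) (b : C_c(finAdelic (↥(maximalRealSubfield L)) L (IsCMField.complexConj L) N H, ℂ)),
      A = (π.restrict (archToAdelic (↥(maximalRealSubfield L)) L (IsCMField.complexConj L) N H)).integratedOperator (hu.restrict _) (hc.restrict _ (continuous_archToAdelic (↥(maximalRealSubfield L)) L (IsCMField.complexConj L) N H)) νinf a ∘L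
          (π.restrict (finAdelicToAdelic (↥(maximalRealSubfield L)) L (IsCMField.complexConj L) N H)).integratedOperator (hu.restrict _) (hc.restrict _ (continuous_finAdelicToAdelic (↥(maximalRealSubfield L)) L (IsCMField.complexConj L) N H)) νf b},
      ∀ x ∈ LinearMap.eqLocus (P : V →ₗ[ℂ] V) LinearMap.id, P (A (((π.restrict (archToAdelic (↥(maximalRealSubfield L)) L (IsCMField.complexConj L) N H)).integratedOperator (hu.restrict _) (hc.restrict _ (continuous_archToAdelic (↥(maximalRealSubfield L)) L (IsCMField.complexConj L) N H)) νinf (h j) ∘L (π.restrict (finAdelicToAdelic (↥(maximalRealSubfield L)) L (IsCMField.complexConj L) N H)).integratedOperator (hu.restrict _) (hc.restrict _ (continuous_finAdelicToAdelic (↥(maximalRealSubfield L)) L (IsCMField.complexConj L) N H)) νf e) x)) = ((π.restrict (archToAdelic (↥(maximalRealSubfield L)) L (IsCMField.complexConj L) N H)).integratedOperator (hu.restrict _) (hc.restrict _ (continuous_archToAdelic (↥(maximalRealSubfield L)) L (IsCMField.complexConj L) N H)) νinf (h j) ∘L (π.restrict (finAdelicToAdelic (↥(maximalRealSubfield L))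 L (IsCMField.complexConj L) N H)).integratedOperator (hu.restrict _) (hc.restrict _ (continuous_finAdelicToAdelic (↥(maximalRealSubfield L)) L (IsCMField.complexConj L) N H)) νf e) (P (A x)))
    (U : V →ₗ[ℂ] Lp E 2 m) (s : J → Ω → ℂ) (hs : ∀ j, MemLp (s j) ∞ m)
    (hU : ∀ j, ∀ v ∈ LinearMap.eqLocus (P : V →ₗ[ℂ] V) LinearMap.id, U (((π.restrict (archToAdelic (↥(maximalRealSubfield L)) L (IsCMField.complexConj L) N H)).integratedOperator (hu.restrict _) (hc.restrict _ (continuous_archToAdelic (↥(maximalRealSubfield L)) L (IsCMField.complexConj L) N H)) νinf (h j) ∘L (π.restrict (finAdelicToAdelic (↥(maximalRealSubfield L)) L (IsCMField.complexConj L) N H)).integratedOperator (hu.restrict _) (hc.restrict _ (continuous_finAdelicToAdelic (↥(maximalRealSubfield L)) L (IsCMField.complexConj L) N H)) νf e) v) = (hs j).toLp (s j) • U v)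
    {Λ : Set Ω} (hΛ : MeasurableSet Λ) (hline : ∀ c : J → ℂ, m (Λ ∩ {x | ∀ j, s j x = c j}) = 0) (hΛ1 : MemLp (Λ.indicator fun _ : Ω => (1 : ℂ)) ∞ m)
    {w : V} (hw : w ∈ W) :
    (hΛ1.toLp (Λ.indicator fun _ : Ω => (1 : ℂ)) • U (P w) : Lp E 2 m) = 0 := by
  have hTP : ∀ j, Commute P ((π.restrict (archToAdelic (↥(maximalRealSubfield L)) L (IsCMField.complexConj L) N H)).integratedOperator (hu.restrict _) (hc.restrict _ (continuous_archToAdelic (↥(maximalRealSubfield L)) L (IsCMField.complexConj L) N H)) νinf (h j) ∘L (π.restrict (finAdelicToAdelic (↥(maximalRealSubfield L)) L (IsCMField.complexConj L) N H)).integratedOperator (hu.restrict _) (hc.restrict _ (continuous_finAdelicToAdelic (↥(maximalRealSubfield L)) L (IsCMField.complexConj L) N H)) νf e) := fun j => by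
    rw [hPdef]
    exact commute_blockProjector_sphericalHecke π hu hc νinf νf κ hκ μ χ e hχmul hχone (h j) (hhl j) (hhr j)
  exact indicator_lpSMul_blockProj_eq_zero_of_irreducible_subrep_cm π hu hc νinf νf κ hκ μ χ e hχmul hχone hχinv K' he0 he1 heK hestar P hPdef W hW
    (fun j => ((π.restrict (archToAdelic (↥(maximalRealSubfield L)) L (IsCMField.complexConj L) N H)).integratedOperator (hu.restrict _) (hc.restrict _ (continuous_archToAdelic (↥(maximalRealSubfield L)) L (IsCMField.complexConj L) N H)) νinf (h j) ∘L (π.restrict (finAdelicToAdelic (↥(maximalRealSubfield L)) L (IsCMField.complexConj L) N H)).integratedOperator (hu.restrict _) (hc.restrict _ (continuous_finAdelicToAdelic (↥(maximalRealSubfield L)) L (IsCMField.complexConj L) N H)) νf e)) (fun j => ⟨h j, e, rfl⟩) hTP hTB U s hs hU hΛ hline hΛ1 hw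

/-- **`Λ = univ`: `U (P w) = 0`** for every vector of every irreducible closed summand, with `T_j = R_∞(h_j) ∘ R_f(e)` and `hT𝓐`∕`hTP` plugged (★ p860487 `lpModel_…` + `commute_blockProjector_sphericalHecke`).
[cite: MoeglinWaldspurger1995, IV.3.12, VI.2] -/
theorem lpModel_blockProj_eq_zero_of_spherical_cm
    (hχmul : ∀ k l, χ (k * l) = χ k * χ l) (hχone : χ 1 = 1) (hχinv : ∀ k, conj (χ k⁻¹) = χ k)
    (K' : Subgroup (finAdelic (↥(maximalRealSubfield L)) L (IsCMField.complexConj L) N H)) (he0 : ∀ x, x ∉ K' → e x = 0) (he1 : ∫ x, e x ∂νf = 1)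
    (heK : ∀ k ∈ K', ∀ x, e (k * x) = e x) (hestar : ∀ x, mulStar (⇑e) x = e x)
    (P : V →L[ℂ] V) (hPdef : P = ((π.restrict ((archToAdelic (↥(maximalRealSubfield L)) L (IsCMField.complexConj L) N H).comp κ)).integratedOperator (hu.restrict _)
          (hc.restrict _ ((continuous_archToAdelic (↥(maximalRealSubfield L)) L (IsCMField.complexConj L) N H).comp hκ)) μ χ ∘L
        (π.restrict (finAdelicToAdelic (↥(maximalRealSubfield L)) L (IsCMField.complexConj L) N H)).integratedOperator (hu.restrict _) (hc.restrict _ (continuous_finAdelicToAdelic (↥(maximalRealSubfield L)) L (IsCMField.complexConj L) N H)) νf e))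
    (W : ClosedSubrep π) (hW : W.toContRep.IsTopIrreducible)
    (h : J → C_c(UnitaryGroup.arch (↥(maximalRealSubfield L)) L (IsCMField.complexConj L) N H, ℂ))
    (hhl : ∀ (j : J) (k : K) (x : UnitaryGroup.arch (↥(maximalRealSubfield L)) L (IsCMField.complexConj L) N H), h j (κ k * x) = χ k * h j x)
    (hhr : ∀ (j : J) (k : K) (x : UnitaryGroup.arch (↥(maximalRealSubfield L)) L (IsCMField.complexConj L) N H), h j (x * κ k) = χ k * h j x)
    (hTB : ∀ j, ∀ A ∈ {A : V →L[ℂ] V | ∃ (a : C_c(UnitaryGroup.arch (↥(maximalRealSubfield L)) L (IsCMField.complexConj L) N H, ℂ)) (b : C_c(finAdelic (↥(maximalRealSubfield L)) L (IsCMField.complexConj L) N H, ℂ)),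
      A = (π.restrict (archToAdelic (↥(maximalRealSubfield L)) L (IsCMField.complexConj L) N H)).integratedOperator (hu.restrict _) (hc.restrict _ (continuous_archToAdelic (↥(maximalRealSubfield L)) L (IsCMField.complexConj L) N H)) νinf a ∘L
          (π.restrict (finAdelicToAdelic (↥(maximalRealSubfield L)) L (IsCMField.complexConj L) N H)).integratedOperator (hu.restrict _) (hc.restrict _ (continuous_finAdelicToAdelic (↥(maximalRealSubfield L)) L (IsCMField.complexConj L) N H)) νf b},
      ∀ x ∈ LinearMap.eqLocus (P : V →ₗ[ℂ] V) LinearMap.id, P (A (((π.restrict (archToAdelic (↥(maximalRealSubfield L)) L (IsCMField.complexConj L) N H)).integratedOperator (hu.restrict _) (hc.restrict _ (continuous_archToAdelic (↥(maximalRealSubfield L)) L (IsCMField.complexConj L) N H)) νinf (h j) ∘L (π.restrict (finAdelicToAdelic (↥(maximalRealSubfield L)) L (IsCMField.complexConj L) N H)).integratedOperator (hu.restrict _) (hc.restrict _ (continuous_finAdelicToAdelic (↥(maximalRealSubfield L)) L (IsCMField.complexConj L) N H)) νf e) x)) = ((π.restrict (archToAdelic (↥(maximalRealSubfield L)) L (IsCMField.complexConj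 L) N H)).integratedOperator (hu.restrict _) (hc.restrict _ (continuous_archToAdelic (↥(maximalRealSubfield L)) L (IsCMField.complexConj L) N H)) νinf (h j) ∘L (π.restrict (finAdelicToAdelic (↥(maximalRealSubfield L)) L (IsCMField.complexConj L) N H)).integratedOperator (hu.restrict _) (hc.restrict _ (continuous_finAdelicToAdelic (↥(maximalRealSubfield L)) L (IsCMField.complexConj L) N H)) νf e) (P (A x)))
    (U : V →ₗ[ℂ] Lp E 2 m) (s : J → Ω → ℂ) (hs : ∀ j, MemLp (s j) ∞ m)
    (hU : ∀ j, ∀ v ∈ LinearMap.eqLocus (P : V →ₗ[ℂ] V) LinearMap.id, U (((π.restrict (archToAdelic (↥(maximalRealSubfield L)) L (IsCMField.complexConj L) N H)).integratedOperator (hu.restrict _) (hc.restrict _ (continuous_archToAdelic (↥(maximalRealSubfield L)) L (IsCMField.complexConj L) N H)) νinf (h j) ∘L (π.restrict (finAdelicToAdelic (↥(maximalRealSubfield L)) L (IsCMField.complexConj L) N H)).integratedOperator (hu.restrict _) (hc.restrict _ (continuous_finAdelicToAdelic (↥(maximalRealSubfield L)) L (IsCMField.complexConj L) N H)) νf e)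 v) = (hs j).toLp (s j) • U v)
    (hline : ∀ c : J → ℂ, m {x | ∀ j, s j x = c j} = 0) {w : V} (hw : w ∈ W) :
    U (P w) = 0 := by
  have hTP : ∀ j, Commute P ((π.restrict (archToAdelic (↥(maximalRealSubfield L)) L (IsCMField.complexConj L) N H)).integratedOperator (hu.restrict _) (hc.restrict _ (continuous_archToAdelic (↥(maximalRealSubfield L)) L (IsCMField.complexConj L) N H)) νinf (h j) ∘L (π.restrict (finAdelicToAdelic (↥(maximalRealSubfield L)) L (IsCMField.complexConj L) N H)).integratedOperator (hu.restrict _) (hc.restrict _ (continuous_finAdelicToAdelic (↥(maximalRealSubfield L)) L (IsCMField.complexConj L) N H)) νf e) := fun j => by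
    rw [hPdef]
    exact commute_blockProjector_sphericalHecke π hu hc νinf νf κ hκ μ χ e hχmul hχone (h j) (hhl j) (hhr j)
  exact lpModel_blockProj_eq_zero_of_irreducible_subrep_cm π hu hc νinf νf κ hκ μ χ e hχmul hχone hχinv K' he0 he1 heK hestar P hPdef W hW
    (fun j => ((π.restrict (archToAdelic (↥(maximalRealSubfield L)) L (IsCMField.complexConj L) N H)).integratedOperator (hu.restrict _) (hc.restrict _ (continuous_archToAdelic (↥(maximalRealSubfield L)) L (IsCMField.complexConj L) N H)) νinf (h j) ∘L (π.restrict (finAdelicToAdelic (↥(maximalRealSubfield L)) L (IsCMField.complexConj L) N H)).integratedOperator (hu.restrict _) (hc.restrict _ (continuous_finAdelicToAdelic (↥(maximalRealSubfield L)) L (IsCMField.complexConj L) N H)) νf e)) (fun j => ⟨h j, e, rfl⟩) hTP hTB U s hs hU hline hw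

end Summit.HodgeConjecture.HodgeConjecture.Cruxes.H413.K2E1IrreducibleNoContinuousSpectrumCMTwoAlgebraFree

end
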